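import Mathlib
import HarnessLib
import Literature.Computability.AlgebraicComplexity.PatternExpressions
import Literature.Combinatorics.SimpleGraph.TreewidthBrambleLowerBound
import Summits.ValiantsHypothesis.ValiantsHypothesis.Theorems.MonotoneRestorationMonotoneRestorationQPLinearWidthDefs
import Summits.ValiantsHypothesis.ValiantsHypothesis.Theorems.MonotoneRestorationMonotoneRestorationQPLinearWidthHomIndistShift
import Summits.ValiantsHypothesis.ValiantsHypothesis.Theorems.MonotoneRestorationOrbitRestorationLinearVolumeQPHomPolyBasics
import Summits.ValiantsHypothesis.ValiantsHypothesis.Theorems.MonotoneRestorationOrbitRestorationLinearVolumeQPSubThresholdDescentTools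

/-!
# Route MonotoneRestoration, crux `MonotoneRestorationQP` (stmt-15886), line `linear_width` —
# THE DIRECT-SUM (DISJOINT-UNION) CONGRUENCE FOR WEIGHTED `HomIndist`

Helper file (`--supports stmt-ValiantsHypothesis-15886`), def-free.

The rung `stub_linearDegreeWidthRestoration` of `Cruxes/MonotoneRestorationQP/Lines/linear_width.lean` is phrased through
the weighted indistinguishability `HomIndist n k A B` (`…LinearWidthDefs.lean`): all homomorphism polynomials of
bipartite multigraph patterns of treewidth `< k` agree at the two points `A, B ∈ ℂ^{n×n}`.  The in-print isolation
toolkit behind descriptive-complexity monotonicity (Dawar–Pago–Seppelt 2025, §7.1.1 and Thm 7.11) uses two congruences of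
homomorphism indistinguishability: the categorical (Kronecker) PRODUCT with a fixed host — landed in weighted currency as
`KroneckerMonotonicity.homIndist_kronecker` (p840674) — and the DISJOINT UNION with a fixed host.  This file lands the
second one in the tree's weighted currency, with no padding and no size condition:

* `eval_add_homPoly` — SUB-PATTERN EXPANSION of a sum of two weightings: `hom_E(u + v) = Σ_{(E₀,E₁) ∈ antidiagonal E}
  Σ_h Π_{E₀} u(h·) · Π_{E₁} v(h·)` (the "mixed sums" of the edge splits of `E`);
* `sum_mixed_eq_zero_of_shared` — if `u` is supported on the block `κ = false` and `v` on the block `κ = true` of a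
  2-colouring `κ` of the indices, the mixed sum of a split whose two halves SHARE a vertex vanishes;
* `sum_mixed_mul_card` — for a split whose halves are VERTEX-DISJOINT, the mixed sum times `n^a · n^b` is the product
  `hom_{E₀}(u) · hom_{E₁}(v)` (a swap involution on pairs of label assignments; no support hypothesis);
* `homIndist_add_of_blockSeparated` — **ONE-LEVEL FORM**: if `u, u'` are supported on the `false` block, `v` on the
  `true` block, and `HomIndist n k u u'`, then `HomIndist n k (u + v) (u' + v)` (sub-patterns `E₀ ≤ E` have treewidth
  `≤ tw E`, `HomIndistShift.treewidth_patternGraph_mono`);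
* `eval_homPoly_zeroExtend`, `homIndist_zeroExtend` — ZERO-EXTENSION along an injection `ι : Fin ν ↪ Fin n` does not
  change the values of isolated-vertex-free patterns and is a congruence for `HomIndist` (isolated vertices are erased
  first: `SubThresholdDescent.exists_eraseIsolated₂`, `homPoly_map_subtype`; the erased pattern embeds, so its treewidth
  does not go up, `treewidth_patternGraph_map_le_of_injective`);
* `homIndist_directSum` — **THE DIRECT-SUM CONGRUENCE**: `HomIndist ν k z z' → HomIndist (ν + m) k (z ⊕ y) (z' ⊕ y)`
  for every weighted `y ∈ ℂ^{m×m}`, the block-diagonal points being `Matrix.fromBlocks z 0 0 y` read through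
  `finSumFinEquiv`.

What this does and does not give (honest label).  Together with `homIndist_kronecker` this completes the weighted form of
the two closure operations of DPS25 §7.1.1 used by the isolation step of Thm 7.11; by itself it isolates, inside a
determined hom expansion at level `ν + m`, only relations over sub-unions of components of volume `≤ ν` (evidence
KRONECKER-MONOTONICITY-g11.md on the item).  Infrastructure for the rung; no stub closed; the rung, the cruxes and
VP ≠ VNP are NOT moved.
[cite: DawarPagoSeppelt2025, §7.1.1, Thm 7.11; Lovasz2012, eq. (5.28)–(5.30); DwivediPagoSeppelt2026, eq. (1)]
-/

set_option linter.dupNamespace false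

noncomputable section

open scoped Classical

namespace Summit.ValiantsHypothesis.ValiantsHypothesis.Theorems.DirectSumCongruence

open MvPolynomial Finset
open Literature.Computability.AlgebraicComplexity
open Literature.Combinatorics.SimpleGraph (treewidth treewidth_le_of_hom_injective)
open Summit.ValiantsHypothesis.ValiantsHypothesis.Theorems.MonotoneRestorationQPLinearWidth

variable {n : ℕ}

/-! ### Mixed sums of an edge split -/

/-- **Sub-pattern expansion of a sum of two weightings**: `hom_E(u + v)` is the sum, over the edge splits
`(E₀, E₁)` of `E` (its antidiagonal), of the MIXED SUMS `Σ_h Π_{e ∈ E₀} u(h e) · Π_{e ∈ E₁} v(h e)`. [folklore] -/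
theorem eval_add_homPoly {a b : ℕ} (E : Multiset (Fin a × Fin b)) (u v : Fin n × Fin n → ℂ) :
    eval (u + v) (homPoly E n ℂ) =
      ((Multiset.antidiagonal E).map fun p =>
        ∑ h : (Fin a → Fin n) × (Fin b → Fin n),
          (p.1.map fun e => u (h.1 e.1, h.2 e.2)).prod * (p.2.map fun e => v (h.1 e.1, h.2 e.2)).prod).sum := by
  rw [HomIndistShift.eval_homPoly]
  have hexp : ∀ h : (Fin a → Fin n) × (Fin b → Fin n),
      (E.map fun e => (u + v) (h.1 e.1, h.2 e.2)).prod =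
        ((Multiset.antidiagonal E).map fun p =>
          (p.1.map fun e => u (h.1 e.1, h.2 e.2)).prod * (p.2.map fun e => v (h.1 e.1, h.2 e.2)).prod).sum :=
    fun h => by
      simp only [Pi.add_apply]
      exact Multiset.prod_map_add
  simp only [hexp]
  rw [Finset.sum_eq_multiset_sum, Multiset.sum_map_sum_map]
  rfl

/-- **A split whose halves share a vertex has vanishing mixed sum** when `u` is supported on the block `κ = false`
and `v` on the block `κ = true`: the shared vertex would have to be mapped into both blocks. [folklore] -/
theorem sum_mixed_eq_zero_of_shared {a b : ℕ} (κ : Fin n → Bool) {u v : Fin n × Fin n → ℂ}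
    (hu : ∀ p q, u (p, q) ≠ 0 → κ p = false ∧ κ q = false)
    (hv : ∀ p q, v (p, q) ≠ 0 → κ p = true ∧ κ q = true)
    (E₀ E₁ : Multiset (Fin a × Fin b))
    (hshare : (∃ i, (∃ e ∈ E₀, e.1 = i) ∧ ∃ e ∈ E₁, e.1 = i) ∨
      ∃ j, (∃ e ∈ E₀, e.2 = j) ∧ ∃ e ∈ E₁, e.2 = j) :
    ∑ h : (Fin a → Fin n) × (Fin b → Fin n),
      (E₀.map fun e => u (h.1 e.1, h.2 e.2)).prod * (E₁.map fun e => v (h.1 e.1, h.2 e.2)).prod = 0 := by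
  refine Finset.sum_eq_zero fun h _ => ?_
  by_contra hne
  obtain ⟨h0, h1⟩ := mul_ne_zero_iff.1 hne
  have f0 : ∀ e ∈ E₀, u (h.1 e.1, h.2 e.2) ≠ 0 := fun e he h0' =>
    h0 (Multiset.prod_eq_zero (Multiset.mem_map.2 ⟨e, he, h0'⟩))
  have f1 : ∀ e ∈ E₁, v (h.1 e.1, h.2 e.2) ≠ 0 := fun e he h1' =>
    h1 (Multiset.prod_eq_zero (Multiset.mem_map.2 ⟨e, he, h1'⟩))
  rcases hshare with ⟨i, ⟨e₀, he₀, rfl⟩, e₁, he₁, hi⟩ | ⟨j, ⟨e₀, he₀, rfl⟩, e₁, he₁, hj⟩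
  · have hf := (hu _ _ (f0 e₀ he₀)).1
    have ht := (hv _ _ (f1 e₁ he₁)).1
    rw [hi, hf] at ht
    exact Bool.false_ne_true ht
  · have hf := (hu _ _ (f0 e₀ he₀)).2
    have ht := (hv _ _ (f1 e₁ he₁)).2
    rw [hj, hf] at ht
    exact Bool.false_ne_true ht

/-- **A split whose halves are vertex-disjoint has a factorising mixed sum**: `(Σ_h Π_{E₀} u(h·) Π_{E₁} v(h·)) · n^a n^b
= hom_{E₀}(u) · hom_{E₁}(v)`.  Proof: on pairs `(h, g)` of label assignments, the involution that swaps the values on the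
vertices of `E₀` turns `Π_{E₀} u(h·) Π_{E₁} v(g·)` into `Π_{E₀} u(h'·) Π_{E₁} v(h'·)`. [folklore] -/
theorem sum_mixed_mul_card {a b : ℕ} (u v : Fin n × Fin n → ℂ) (E₀ E₁ : Multiset (Fin a × Fin b))
    (hrow : ∀ i, (∃ e ∈ E₀, e.1 = i) → (∃ e ∈ E₁, e.1 = i) → False)
    (hcol : ∀ j, (∃ e ∈ E₀, e.2 = j) → (∃ e ∈ E₁, e.2 = j) → False) :
    (∑ h : (Fin a → Fin n) × (Fin b → Fin n),
        (E₀.map fun e => u (h.1 e.1, h.2 e.2)).prod * (E₁.map fun e => v (h.1 e.1, h.2 e.2)).prod) *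
        ((n ^ a * n ^ b : ℕ) : ℂ) =
      eval u (homPoly E₀ n ℂ) * eval v (homPoly E₁ n ℂ) := by
  let H := (Fin a → Fin n) × (Fin b → Fin n)
  let U : H → ℂ := fun h => (E₀.map fun e => u (h.1 e.1, h.2 e.2)).prod
  let V : H → ℂ := fun h => (E₁.map fun e => v (h.1 e.1, h.2 e.2)).prod
  let mrg : H → H → H := fun h g =>
    (fun i => if ∃ e ∈ E₀, e.1 = i then h.1 i else g.1 i,
      fun j => if ∃ e ∈ E₀, e.2 = j then h.2 j else g.2 j)
  let Φ : H × H → H × H := fun hg => (mrg hg.1 hg.2, mrg hg.2 hg.1)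
  have hΦ : Function.Involutive Φ := by
    rintro ⟨h, g⟩
    refine Prod.ext (Prod.ext (funext fun i => ?_) (funext fun j => ?_))
      (Prod.ext (funext fun i => ?_) (funext fun j => ?_))
    all_goals (simp only [Φ, mrg]; split_ifs <;> rfl)
  have hU : ∀ h g : H, U (mrg h g) = U h := fun h g => by
    refine congrArg Multiset.prod (Multiset.map_congr rfl fun e he => ?_)
    have hP : ∃ e' ∈ E₀, e'.1 = e.1 := ⟨e, he, rfl⟩
    have hQ : ∃ e' ∈ E₀, e'.2 = e.2 := ⟨e, he, rfl⟩
    simp only [mrg, if_pos hP, if_pos hQ]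
  have hV : ∀ h g : H, V (mrg h g) = V g := fun h g => by
    refine congrArg Multiset.prod (Multiset.map_congr rfl fun e he => ?_)
    have hP : ¬ ∃ e' ∈ E₀, e'.1 = e.1 := fun hP => hrow e.1 hP ⟨e, he, rfl⟩
    have hQ : ¬ ∃ e' ∈ E₀, e'.2 = e.2 := fun hQ => hcol e.2 hQ ⟨e, he, rfl⟩
    simp only [mrg, if_neg hP, if_neg hQ]
  have hcard : Fintype.card H = n ^ a * n ^ b := by
    show Fintype.card ((Fin a → Fin n) × (Fin b → Fin n)) = _
    simp only [Fintype.card_prod, Fintype.card_fun, Fintype.card_fin]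
  show (∑ h : H, U h * V h) * ((n ^ a * n ^ b : ℕ) : ℂ) = _
  calc (∑ h : H, U h * V h) * ((n ^ a * n ^ b : ℕ) : ℂ)
      = ∑ h : H, ∑ _g : H, U h * V h := by
        rw [Finset.sum_mul]
        refine Finset.sum_congr rfl fun h _ => ?_
        rw [Finset.sum_const, Finset.card_univ, hcard, nsmul_eq_mul, mul_comm]
    _ = ∑ hg : H × H, U hg.1 * V hg.1 := (Fintype.sum_prod_type fun hg : H × H => U hg.1 * V hg.1).symm
    _ = ∑ hg : H × H, U (Φ hg).1 * V (Φ hg).1 := by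
        rw [← Equiv.sum_comp (Function.Involutive.toPerm Φ hΦ) fun hg : H × H => U hg.1 * V hg.1]
        rfl
    _ = ∑ hg : H × H, U hg.1 * V hg.2 := Finset.sum_congr rfl fun hg _ => by
        show U (mrg hg.1 hg.2) * V (mrg hg.1 hg.2) = _
        rw [hU, hV]
    _ = (∑ h : H, U h) * ∑ g : H, V g := by
        rw [Fintype.sum_prod_type' (fun h g : H => U h * V g), Finset.sum_mul_sum]
    _ = eval u (homPoly E₀ n ℂ) * eval v (homPoly E₁ n ℂ) := by
        rw [HomIndistShift.eval_homPoly, HomIndistShift.eval_homPoly]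

/-! ### The one-level congruence -/

/-- **ONE-LEVEL FORM OF THE DIRECT-SUM CONGRUENCE.**  Let `κ` be a 2-colouring of the indices `Fin n`, let `u, u'` be
supported on the block `κ = false` (both coordinates) and `v` on the block `κ = true`.  If `u, u'` are
hom-indistinguishable below treewidth `k`, then so are `u + v` and `u' + v`.  (Expand both sides over the edge splits of
the pattern; splits sharing a vertex vanish, vertex-disjoint splits factor through `hom_{E₀}(u) = hom_{E₀}(u')`, the
sub-pattern `E₀ ≤ E` having treewidth `≤ tw E < k`.) [cite: DawarPagoSeppelt2025, §7.1.1; Lovasz2012, eq. (5.28)] -/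
theorem homIndist_add_of_blockSeparated {k : ℕ} (κ : Fin n → Bool) {u u' v : Fin n × Fin n → ℂ}
    (hu : ∀ p q, u (p, q) ≠ 0 → κ p = false ∧ κ q = false)
    (hu' : ∀ p q, u' (p, q) ≠ 0 → κ p = false ∧ κ q = false)
    (hv : ∀ p q, v (p, q) ≠ 0 → κ p = true ∧ κ q = true)
    (h : HomIndist n k u u') : HomIndist n k (u + v) (u' + v) := by
  rcases Nat.eq_zero_or_pos n with rfl | hn
  · have : u = u' := funext fun pq => Fin.elim0 pq.1
    subst this
    intro a b E _
    rfl
  intro a b E htw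
  rw [eval_add_homPoly, eval_add_homPoly]
  refine congrArg _ (Multiset.map_congr rfl fun p hp => ?_)
  have hle : p.1 ≤ E := by
    rw [Multiset.mem_antidiagonal] at hp
    rw [← hp]
    exact Multiset.le_add_right _ _
  by_cases hshare : (∃ i, (∃ e ∈ p.1, e.1 = i) ∧ ∃ e ∈ p.2, e.1 = i) ∨
      ∃ j, (∃ e ∈ p.1, e.2 = j) ∧ ∃ e ∈ p.2, e.2 = j
  · rw [sum_mixed_eq_zero_of_shared κ hu hv p.1 p.2 hshare,
      sum_mixed_eq_zero_of_shared κ hu' hv p.1 p.2 hshare]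
  · rw [not_or, not_exists, not_exists] at hshare
    have hrow : ∀ i, (∃ e ∈ p.1, e.1 = i) → (∃ e ∈ p.2, e.1 = i) → False :=
      fun i h0 h1 => hshare.1 i ⟨h0, h1⟩
    have hcol : ∀ j, (∃ e ∈ p.1, e.2 = j) → (∃ e ∈ p.2, e.2 = j) → False :=
      fun j h0 h1 => hshare.2 j ⟨h0, h1⟩
    have hE₀ : eval u (homPoly p.1 n ℂ) = eval u' (homPoly p.1 n ℂ) :=
      h a b p.1 ((HomIndistShift.treewidth_patternGraph_mono hle).trans_lt htw)
    have hpos : 0 < n ^ a * n ^ b := by positivity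
    have hcard : ((n ^ a * n ^ b : ℕ) : ℂ) ≠ 0 := Nat.cast_ne_zero.2 hpos.ne'
    apply mul_right_cancel₀ hcard
    rw [sum_mixed_mul_card u v p.1 p.2 hrow hcol, sum_mixed_mul_card u' v p.1 p.2 hrow hcol, hE₀]

/-! ### Zero-extension along an injection -/

/-- Pushing a bipartite pattern forward along INJECTIVE maps of its row- and column-vertices embeds its pattern graph,
so the treewidth does not go down. [folklore] -/
theorem treewidth_patternGraph_map_le_of_injective {A B A' B' : Type} [Fintype A] [Fintype B] [Fintype A']
    [Fintype B'] [DecidableEq A] [DecidableEq B] [DecidableEq A'] [DecidableEq B'] (F : Multiset (A × B))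
    (f : A → A') (g : B → B') (hf : Function.Injective f) (hg : Function.Injective g) :
    treewidth (SimpleGraph.fromRel fun x y : A ⊕ B => ∃ e ∈ F, x = Sum.inl e.1 ∧ y = Sum.inr e.2) ≤
      treewidth (SimpleGraph.fromRel fun x y : A' ⊕ B' =>
        ∃ e ∈ F.map (fun e => (f e.1, g e.2)), x = Sum.inl e.1 ∧ y = Sum.inr e.2) := by
  have hinj : Function.Injective (Sum.map f g) := Sum.map_injective.2 ⟨hf, hg⟩
  refine treewidth_le_of_hom_injective
    (G := SimpleGraph.fromRel fun x y : A ⊕ B => ∃ e ∈ F, x = Sum.inl e.1 ∧ y = Sum.inr e.2)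
    { toFun := Sum.map f g
      map_rel' := ?_ } hinj
  intro x y hxy
  rw [SimpleGraph.fromRel_adj] at hxy ⊢
  obtain ⟨hne, hh⟩ := hxy
  refine ⟨fun h' => hne (hinj h'), ?_⟩
  rcases hh with ⟨e, he, rfl, rfl⟩ | ⟨e, he, rfl, rfl⟩
  · exact Or.inl ⟨(f e.1, g e.2), Multiset.mem_map_of_mem _ he, rfl, rfl⟩
  · exact Or.inr ⟨(f e.1, g e.2), Multiset.mem_map_of_mem _ he, rfl, rfl⟩

/-- **Zero-extension does not change the values of isolated-vertex-free patterns.**  Let `ι : Fin ν → Fin n` be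
injective, `W` a weighting of level `n` that reads `w` on `ι × ι` and vanishes off it, and `F` a pattern all of whose
row- and column-vertices are covered by edges.  Then `hom_{F,n}(W) = hom_{F,ν}(w)`: a label assignment contributes only
if it factors through `ι`. [folklore] -/
theorem eval_homPoly_zeroExtend {ν : ℕ} (ι : Fin ν → Fin n) (hι : Function.Injective ι)
    {w : Fin ν × Fin ν → ℂ} {W : Fin n × Fin n → ℂ}
    (hW : ∀ i j, W (ι i, ι j) = w (i, j)) (hW0 : ∀ p q, W (p, q) ≠ 0 → (∃ i, ι i = p) ∧ ∃ j, ι j = q)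
    {a b : ℕ} (F : Multiset (Fin a × Fin b)) (hrow : ∀ i, ∃ e ∈ F, e.1 = i) (hcol : ∀ j, ∃ e ∈ F, e.2 = j) :
    eval W (homPoly F n ℂ) = eval w (homPoly F ν ℂ) := by
  rw [HomIndistShift.eval_homPoly, HomIndistShift.eval_homPoly]
  let emb : (Fin a → Fin ν) × (Fin b → Fin ν) → (Fin a → Fin n) × (Fin b → Fin n) :=
    fun g => (ι ∘ g.1, ι ∘ g.2)
  have hemb : Function.Injective emb := by
    intro g g' hgg'
    simp only [emb, Prod.mk.injEq] at hgg'
    exact Prod.ext (funext fun i => hι (congr_fun hgg'.1 i)) (funext fun j => hι (congr_fun hgg'.2 j))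
  have step1 : ∑ g : (Fin a → Fin ν) × (Fin b → Fin ν), (F.map fun e => w (g.1 e.1, g.2 e.2)).prod =
      ∑ g : (Fin a → Fin ν) × (Fin b → Fin ν), (F.map fun e => W ((emb g).1 e.1, (emb g).2 e.2)).prod :=
    Finset.sum_congr rfl fun g _ => congrArg Multiset.prod (Multiset.map_congr rfl fun e _ => (hW _ _).symm)
  have step2 : ∑ g : (Fin a → Fin ν) × (Fin b → Fin ν), (F.map fun e => W ((emb g).1 e.1, (emb g).2 e.2)).prod =
      ∑ h ∈ (Finset.univ : Finset ((Fin a → Fin ν) × (Fin b → Fin ν))).image emb,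
        (F.map fun e => W (h.1 e.1, h.2 e.2)).prod :=
    (Finset.sum_image (f := fun h : (Fin a → Fin n) × (Fin b → Fin n) =>
      (F.map fun e => W (h.1 e.1, h.2 e.2)).prod) fun g _ g' _ hh => hemb hh).symm
  rw [step1, step2]
  refine (Finset.sum_subset (Finset.subset_univ _) fun h _ hnot => ?_).symm
  by_contra hne
  apply hnot
  have f1 : ∀ e ∈ F, W (h.1 e.1, h.2 e.2) ≠ 0 := fun e he h0 =>
    hne (Multiset.prod_eq_zero (Multiset.mem_map.2 ⟨e, he, h0⟩))
  have r1 : ∀ i, ∃ i', ι i' = h.1 i := fun i => by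
    obtain ⟨e, he, rfl⟩ := hrow i
    exact (hW0 _ _ (f1 e he)).1
  have r2 : ∀ j, ∃ j', ι j' = h.2 j := fun j => by
    obtain ⟨e, he, rfl⟩ := hcol j
    exact (hW0 _ _ (f1 e he)).2
  choose g1 hg1 using r1
  choose g2 hg2 using r2
  exact Finset.mem_image.2 ⟨(g1, g2), Finset.mem_univ _, Prod.ext (funext hg1) (funext hg2)⟩

/-- **ZERO-EXTENSION IS A CONGRUENCE FOR `HomIndist`** (hypothesis form).  If `Z, Z'` of level `n` read `z, z'` on
`ι × ι` for an injection `ι : Fin ν → Fin n` and vanish off it, then `HomIndist ν k z z' → HomIndist n k Z Z'`.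
(Isolated vertices are erased first — they rescale both sides by the same power of `n` — and the erased pattern, which
embeds in the original one, has no larger treewidth.) [cite: DawarPagoSeppelt2025, §7.1.1] -/
theorem homIndist_zeroExtend {ν k : ℕ} (ι : Fin ν → Fin n) (hι : Function.Injective ι)
    {z z' : Fin ν × Fin ν → ℂ} {Z Z' : Fin n × Fin n → ℂ}
    (hZ : ∀ i j, Z (ι i, ι j) = z (i, j)) (hZ0 : ∀ p q, Z (p, q) ≠ 0 → (∃ i, ι i = p) ∧ ∃ j, ι j = q)
    (hZ' : ∀ i j, Z' (ι i, ι j) = z' (i, j)) (hZ'0 : ∀ p q, Z' (p, q) ≠ 0 → (∃ i, ι i = p) ∧ ∃ j, ι j = q)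
    (h : HomIndist ν k z z') : HomIndist n k Z Z' := by
  intro a b E htw
  obtain ⟨F', hF'E, hrow, hcol, -⟩ := SubThresholdDescent.exists_eraseIsolated₂ E
  -- transport the erased pattern to `Fin` vertex types
  let ea := Fintype.equivFin {i : Fin a // ∃ e ∈ E, e.1 = i}
  let eb := Fintype.equivFin {j : Fin b // ∃ e ∈ E, e.2 = j}
  let F'' : Multiset (Fin (Fintype.card {i : Fin a // ∃ e ∈ E, e.1 = i}) ×
      Fin (Fintype.card {j : Fin b // ∃ e ∈ E, e.2 = j})) := F'.map fun e => (ea e.1, eb e.2)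
  have hF'' : ∀ m, homPoly F'' m ℂ = homPoly F' m ℂ := fun m => HomPolyBasics.homPoly_map_equiv F' ea eb m
  have hE : ∀ m, homPoly E m ℂ =
      (m ^ Fintype.card {i : Fin a // ¬ ∃ e ∈ E, e.1 = i} * m ^ Fintype.card {j : Fin b // ¬ ∃ e ∈ E, e.2 = j}) •
        homPoly F'' m ℂ := fun m => by
    have key := SubThresholdDescent.homPoly_map_subtype _ _ F' m
    rw [hF'E] at key
    rw [hF'']
    exact key
  have hrow'' : ∀ i, ∃ e ∈ F'', e.1 = i := fun i => by
    obtain ⟨e, he, hei⟩ := hrow (ea.symm i)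
    exact ⟨(ea e.1, eb e.2), Multiset.mem_map_of_mem _ he, by simp [hei]⟩
  have hcol'' : ∀ j, ∃ e ∈ F'', e.2 = j := fun j => by
    obtain ⟨e, he, hej⟩ := hcol (eb.symm j)
    exact ⟨(ea e.1, eb e.2), Multiset.mem_map_of_mem _ he, by simp [hej]⟩
  -- the erased pattern embeds in `E`, so its treewidth is still `< k`
  have hmapE : F''.map (fun e => (((ea.symm e.1 : {i : Fin a // ∃ e ∈ E, e.1 = i}) : Fin a),
      ((eb.symm e.2 : {j : Fin b // ∃ e ∈ E, e.2 = j}) : Fin b))) = E := by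
    refine Eq.trans ?_ hF'E
    simp only [F'', Multiset.map_map, Function.comp_def, Equiv.symm_apply_apply]
  have htw'' : treewidth (patternGraph F'') < k := by
    refine lt_of_le_of_lt ?_ htw
    have hle := treewidth_patternGraph_map_le_of_injective F''
      (fun x => ((ea.symm x : {i : Fin a // ∃ e ∈ E, e.1 = i}) : Fin a))
      (fun y => ((eb.symm y : {j : Fin b // ∃ e ∈ E, e.2 = j}) : Fin b))
      (Subtype.val_injective.comp ea.symm.injective) (Subtype.val_injective.comp eb.symm.injective)
    rw [hmapE] at hle
    exact hle
  rw [hE n, map_nsmul, map_nsmul, eval_homPoly_zeroExtend ι hι hZ hZ0 F'' hrow'' hcol'',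
    eval_homPoly_zeroExtend ι hι hZ' hZ'0 F'' hrow'' hcol'', h _ _ F'' htw'']

/-! ### The direct-sum congruence -/

/-- **THE DIRECT-SUM (DISJOINT-UNION) CONGRUENCE FOR WEIGHTED `HomIndist`.**  If `z, z' ∈ ℂ^{ν×ν}` are
hom-indistinguishable below treewidth `k`, then so are the block-diagonal points `z ⊕ y`, `z' ⊕ y ∈ ℂ^{(ν+m)×(ν+m)}` for
every weighted `y ∈ ℂ^{m×m}` (the weighted disjoint union with a common host; blocks read through `finSumFinEquiv`).
The additive companion of `KroneckerMonotonicity.homIndist_kronecker`.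
[cite: DawarPagoSeppelt2025, §7.1.1, Thm 7.11; Lovasz2012, eq. (5.28)] -/
theorem homIndist_directSum {ν m k : ℕ} {z z' : Fin ν × Fin ν → ℂ} (h : HomIndist ν k z z')
    (y : Fin m × Fin m → ℂ) :
    HomIndist (ν + m) k
      (fun pq => Matrix.fromBlocks (Matrix.of fun i j => z (i, j)) 0 0 (Matrix.of fun i j => y (i, j))
        (finSumFinEquiv.symm pq.1) (finSumFinEquiv.symm pq.2))
      (fun pq => Matrix.fromBlocks (Matrix.of fun i j => z' (i, j)) 0 0 (Matrix.of fun i j => y (i, j))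
        (finSumFinEquiv.symm pq.1) (finSumFinEquiv.symm pq.2)) := by
  -- the two summands and the block colouring
  let Z : Fin (ν + m) × Fin (ν + m) → ℂ := fun pq =>
    Matrix.fromBlocks (Matrix.of fun i j => z (i, j)) 0 0 (0 : Matrix (Fin m) (Fin m) ℂ)
      (finSumFinEquiv.symm pq.1) (finSumFinEquiv.symm pq.2)
  let Z' : Fin (ν + m) × Fin (ν + m) → ℂ := fun pq =>
    Matrix.fromBlocks (Matrix.of fun i j => z' (i, j)) 0 0 (0 : Matrix (Fin m) (Fin m) ℂ)
      (finSumFinEquiv.symm pq.1) (finSumFinEquiv.symm pq.2)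
  let Y : Fin (ν + m) × Fin (ν + m) → ℂ := fun pq =>
    Matrix.fromBlocks (0 : Matrix (Fin ν) (Fin ν) ℂ) 0 0 (Matrix.of fun i j => y (i, j))
      (finSumFinEquiv.symm pq.1) (finSumFinEquiv.symm pq.2)
  let κ : Fin (ν + m) → Bool := fun p => (finSumFinEquiv.symm p).isRight
  have hsplit : ∀ x : Fin ν × Fin ν → ℂ,
      (fun pq : Fin (ν + m) × Fin (ν + m) =>
        Matrix.fromBlocks (Matrix.of fun i j => x (i, j)) 0 0 (Matrix.of fun i j => y (i, j))
          (finSumFinEquiv.symm pq.1) (finSumFinEquiv.symm pq.2)) =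
      (fun pq => Matrix.fromBlocks (Matrix.of fun i j => x (i, j)) 0 0 (0 : Matrix (Fin m) (Fin m) ℂ)
          (finSumFinEquiv.symm pq.1) (finSumFinEquiv.symm pq.2)) + Y := fun x => by
    funext pq
    simp only [Y, Pi.add_apply]
    rw [← Matrix.add_apply, Matrix.fromBlocks_add, add_zero, add_zero, zero_add, zero_add]
  rw [hsplit z, hsplit z']
  show HomIndist (ν + m) k (Z + Y) (Z' + Y)
  -- support of the summands
  have hsuppZ : ∀ (x : Fin ν × Fin ν → ℂ) (p q : Fin (ν + m)),
      Matrix.fromBlocks (Matrix.of fun i j => x (i, j)) 0 0 (0 : Matrix (Fin m) (Fin m) ℂ)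
          (finSumFinEquiv.symm p) (finSumFinEquiv.symm q) ≠ 0 →
        (∃ i, finSumFinEquiv.symm p = Sum.inl i) ∧ ∃ j, finSumFinEquiv.symm q = Sum.inl j := by
    intro x p q hne
    rcases hp : finSumFinEquiv.symm p with i | i <;> rcases hq : finSumFinEquiv.symm q with j | j <;>
      simp [hp, hq] at hne ⊢
  have hκZ : ∀ (x : Fin ν × Fin ν → ℂ) (p q : Fin (ν + m)),
      Matrix.fromBlocks (Matrix.of fun i j => x (i, j)) 0 0 (0 : Matrix (Fin m) (Fin m) ℂ)
          (finSumFinEquiv.symm p) (finSumFinEquiv.symm q) ≠ 0 → κ p = false ∧ κ q = false := by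
    intro x p q hne
    obtain ⟨⟨i, hi⟩, j, hj⟩ := hsuppZ x p q hne
    simp only [κ, hi, hj, Sum.isRight_inl, and_self]
  have hκY : ∀ p q : Fin (ν + m), Y (p, q) ≠ 0 → κ p = true ∧ κ q = true := by
    intro p q hne
    simp only [Y] at hne
    rcases hp : finSumFinEquiv.symm p with i | i <;> rcases hq : finSumFinEquiv.symm q with j | j <;>
      simp [hp, hq, κ] at hne ⊢
  -- zero-extension of `z, z'` along the first block
  let ι : Fin ν → Fin (ν + m) := fun i => finSumFinEquiv (Sum.inl i)
  have hι : Function.Injective ι := fun i j hij => by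
    simpa [ι] using hij
  have hread : ∀ (x : Fin ν × Fin ν → ℂ) (i j : Fin ν),
      Matrix.fromBlocks (Matrix.of fun i j => x (i, j)) 0 0 (0 : Matrix (Fin m) (Fin m) ℂ)
          (finSumFinEquiv.symm (ι i)) (finSumFinEquiv.symm (ι j)) = x (i, j) := by
    intro x i j
    simp [ι]
  have hoff : ∀ (x : Fin ν × Fin ν → ℂ) (p q : Fin (ν + m)),
      Matrix.fromBlocks (Matrix.of fun i j => x (i, j)) 0 0 (0 : Matrix (Fin m) (Fin m) ℂ)
          (finSumFinEquiv.symm p) (finSumFinEquiv.symm q) ≠ 0 → (∃ i, ι i = p) ∧ ∃ j, ι j = q := by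
    intro x p q hne
    obtain ⟨⟨i, hi⟩, j, hj⟩ := hsuppZ x p q hne
    refine ⟨⟨i, ?_⟩, j, ?_⟩
    · simp only [ι, ← hi, Equiv.apply_symm_apply]
    · simp only [ι, ← hj, Equiv.apply_symm_apply]
  have hZZ' : HomIndist (ν + m) k Z Z' :=
    homIndist_zeroExtend ι hι (fun i j => hread z i j) (fun p q => hoff z p q)
      (fun i j => hread z' i j) (fun p q => hoff z' p q) h
  exact homIndist_add_of_blockSeparated κ (fun p q => hκZ z p q) (fun p q => hκZ z' p q) hκY hZZ'

end Summit.ValiantsHypothesis.ValiantsHypothesis.Theorems.DirectSumCongruence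

end
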